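/- LEAD seat `ym-line-cbag-p1` (prover-ym-line-cbag-p1-g24-0), route `EguchiKawaiDirectionLadder` (ideator ym-idea-2, LINE 8),
crux K_A `TripleSmallBallMargin` (stmt-QuantumFields-27724), architecture note ARCH-27724-lead-g24 §1 (S4): the PAIR SMALL-BALL
BOUND — the `d = 2` unconditional Eguchi–Kawai small-ball estimate `ekHaar 2 N {S_R ≤ t} ≲ t^{N(N−1)/2}` — DERIVED from the entrywise
rigidity bound (S1/S2, typed here as the hypothesis `EntrywiseRigidity`; w3's engine) and Weyl's integral formula (PROVED in the tree),
by ONE conditioning on the first link.  ROUTE-INDEPENDENT (no Theses import).  Nothing here bears on the Yang–Mills mass gap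
(barrier-ledger line onto `EguchiKawaiBreakdown`). -/
import Summits.QuantumFields.YangMills.Theorems.EguchiKawaiDirectionLadderWeylSupBound
import Summits.QuantumFields.YangMills.Theorems.EguchiKawaiDirectionLadderSingleLinkReductionCore
import Summits.QuantumFields.YangMills.Theorems.EguchiKawaiDirectionLadderRigidityDefs
import HarnessLib

/-!
# Route `EguchiKawaiDirectionLadder`, crux `TripleSmallBallMargin`: the pair small-ball bound from entrywise rigidity (S4)

`pairSmallBall_of_entrywiseRigidity : EntrywiseRigidity → PairSmallBall` (objects in `…RigidityDefs`).
PROOF: `ekHaar 2 N {S_R ≤ t} = ∫ Haar{W : S_R(U,W) ≤ t} dHaar(U)` (product structure, `ekHaar_two_eq_lintegral_pairFibre`); the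
integrand is a measurable CLASS FUNCTION of `U` (`haar_pair_conj`, w2); on the diagonal torus it is bounded by `EntrywiseRigidity`; the Weyl
sup bound (`lintegral_haar_le_of_classFunction` + `weylWeight_mul_le_of_pairwise`, file `…WeylSupBound`) prices it at
`exp(N²(C − η log t)) (κt)^{C(N,2)}` since `|d_j − d_k|² · pairFactor (κt) |d_j − d_k|² ≤ κt`; `κ^{C(N,2)} ≤ exp(N² log κ)` goes into the constant.
-/

set_option autoImplicit false

noncomputable section

open MeasureTheory
open scoped ENNReal
open Literature.Barriers.QuantumFields

namespace Summit.QuantumFields.YangMills.Theorems.EguchiKawaiDirectionLadder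

open Literature.MathematicalPhysics.QuantumFieldTheory (haarProbability)
open Literature.LinearAlgebra.Matrix (diagonalTorus)
open Literature.RepresentationTheory.CompactGroups.WeylIntegration (weylWeight)

variable {N : ℕ}

/-! ### Plumbing: the two-link measure as a product, the fibre function -/

/-- The pair event is closed, hence measurable (as a subset of `U(N) × U(N)`). -/
theorem measurableSet_pairEvent (t : ℝ) :
    MeasurableSet {p : UN N × UN N | ekAction ((![p.1, p.2] : EKConfig 2 N)) ≤ t} := by
  refine (isClosed_le ?_ continuous_const).measurableSet
  refine continuous_ekAction.comp (continuous_pi fun i => ?_)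
  fin_cases i
  · simpa using continuous_fst
  · simpa using continuous_snd

/-- The fibre event `{W : S_R(U, W) ≤ t}` is measurable. -/
theorem measurableSet_pairFibre (U : UN N) (t : ℝ) :
    MeasurableSet {W : UN N | ekAction ((![U, W] : EKConfig 2 N)) ≤ t} :=
  measurable_prodMk_left (measurableSet_pairEvent (N := N) t)

/-- The fibre function `U ↦ Haar{W : S_R(U, W) ≤ t}` is measurable. -/
theorem measurable_pairFibre (t : ℝ) :
    Measurable fun U : UN N => haarProbability (UN N) {W : UN N | ekAction ((![U, W] : EKConfig 2 N)) ≤ t} :=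
  measurable_measure_prodMk_left (measurableSet_pairEvent (N := N) t)

/-- The fibre function is a class function (w2's `haar_pair_conj`). -/
theorem pairFibre_conj (t : ℝ) (g u : UN N) :
    haarProbability (UN N) {W : UN N | ekAction ((![g * u * g⁻¹, W] : EKConfig 2 N)) ≤ t} =
      haarProbability (UN N) {W : UN N | ekAction ((![u, W] : EKConfig 2 N)) ≤ t} :=
  haar_pair_conj u g t

/-- A configuration of two links is the pair of its links: `![U 0, U 1] = U`. -/
theorem vecCons_eta_two (U : EKConfig 2 N) : (![U 0, U 1] : EKConfig 2 N) = U := by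
  funext i
  fin_cases i <;> rfl

/-- **Product structure of the two-link measure**: `ekHaar 2 N {S_R ≤ t} = ∫ Haar{W : S_R(U,W) ≤ t} dHaar(U)`. -/
theorem ekHaar_two_eq_lintegral_pairFibre (t : ℝ) :
    ekHaar 2 N {U : EKConfig 2 N | ekAction U ≤ t} =
      ∫⁻ U, haarProbability (UN N) {W : UN N | ekAction ((![U, W] : EKConfig 2 N)) ≤ t} ∂haarProbability (UN N) := by
  have hmp : MeasurePreserving (MeasurableEquiv.finTwoArrow (α := UN N)) (ekHaar 2 N)
      ((haarProbability (UN N)).prod (haarProbability (UN N))) := by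
    unfold ekHaar
    exact MeasureTheory.measurePreserving_finTwoArrow (haarProbability (UN N))
  have hset : {U : EKConfig 2 N | ekAction U ≤ t} =
      MeasurableEquiv.finTwoArrow ⁻¹' {p : UN N × UN N | ekAction ((![p.1, p.2] : EKConfig 2 N)) ≤ t} := by
    ext U
    simp only [Set.mem_setOf_eq, Set.mem_preimage, MeasurableEquiv.finTwoArrow_apply, vecCons_eta_two]
  rw [hset, hmp.measure_preimage (measurableSet_pairEvent t).nullMeasurableSet,
    Measure.prod_apply (measurableSet_pairEvent t)]
  rfl

/-! ### The pair small-ball bound -/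

/-- `C(N,2) ≤ N²` in `ℝ` (the exponent count is at most `N²`). -/
theorem cast_choose_two_le_sq (N : ℕ) : ((N.choose 2 : ℕ) : ℝ) ≤ (N : ℝ) ^ 2 := by
  rw [Nat.cast_choose_two]
  nlinarith [Nat.cast_nonneg (α := ℝ) N]

/-- **S4: entrywise rigidity ⇒ the pair small-ball bound** (one conditioning on the first link + the Weyl sup bound). -/
theorem pairSmallBall_of_entrywiseRigidity (hE : EntrywiseRigidity) : PairSmallBall := by
  intro η hη
  obtain ⟨κ, hκ, C, hC, N₀, h⟩ := hE η hη
  refine ⟨C + Real.log κ, add_nonneg hC (Real.log_nonneg hκ), N₀, fun N hN t ht ht1 => ?_⟩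
  have hκt : 0 ≤ κ * t := mul_nonneg (zero_le_one.trans hκ) ht.le
  rw [ekHaar_two_eq_lintegral_pairFibre]
  -- the Weyl sup bound for the class function `U ↦ Haar{W : S_R(U,W) ≤ t}`
  have hmain : ∫⁻ U, haarProbability (UN N) {W : UN N | ekAction ((![U, W] : EKConfig 2 N)) ≤ t} ∂haarProbability (UN N) ≤
      ENNReal.ofReal (Real.exp ((N : ℝ) ^ 2 * (C - η * Real.log t)) * (κ * t) ^ N.choose 2) := by
    refine lintegral_haar_le_of_classFunction (measurable_pairFibre t) (pairFibre_conj t) fun τ => ?_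
    obtain ⟨d, hd, hd1⟩ := exists_diagonalTorus_eq_diagonal τ
    exact weylWeight_mul_le_of_pairwise hd (Real.exp_pos _).le (fun j k => pairFactor_nonneg hκt _)
      (h N hN t ht ht1 (τ : UN N) d hd) fun j k _ => mul_pairFactor_le hκt _
  refine hmain.trans (ENNReal.ofReal_le_ofReal ?_)
  -- absorb `κ^{N(N−1)/2} ≤ exp(N² log κ)` into the constant
  rw [mul_pow]
  have hκP : κ ^ N.choose 2 ≤ Real.exp ((N : ℝ) ^ 2 * Real.log κ) := by
    rw [← Real.rpow_natCast, Real.rpow_def_of_pos (lt_of_lt_of_le zero_lt_one hκ), mul_comm]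
    exact Real.exp_le_exp.2 (mul_le_mul_of_nonneg_right (cast_choose_two_le_sq N) (Real.log_nonneg hκ))
  have htP : 0 ≤ t ^ N.choose 2 := pow_nonneg ht.le _
  calc Real.exp ((N : ℝ) ^ 2 * (C - η * Real.log t)) * (κ ^ N.choose 2 * t ^ N.choose 2)
      ≤ Real.exp ((N : ℝ) ^ 2 * (C - η * Real.log t)) * (Real.exp ((N : ℝ) ^ 2 * Real.log κ) * t ^ N.choose 2) :=
        mul_le_mul_of_nonneg_left (mul_le_mul_of_nonneg_right hκP htP) (Real.exp_pos _).le
    _ = Real.exp ((N : ℝ) ^ 2 * (C + Real.log κ - η * Real.log t)) * t ^ N.choose 2 := by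
        rw [← mul_assoc, ← Real.exp_add]; ring_nf

end Summit.QuantumFields.YangMills.Theorems.EguchiKawaiDirectionLadder

end
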